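import Mathlib
import Summits.NavierStokesRegularity.NavierStokesRegularity.Theorems.TypeIQuarterGateScarEnvelopeTypeIZoomDictionaryDefs
import Summits.NavierStokesRegularity.NavierStokesRegularity.Theorems.TypeIQuarterGateScarEnvelopeTypeIFatKill
import Summits.NavierStokesRegularity.NavierStokesRegularity.Theorems.TypeIQuarterGateScarEnvelopeTypeIBudgetViolators
import Summits.NavierStokesRegularity.NavierStokesRegularity.Theorems.TypeIQuarterGateScarEnvelopeTypeIOfNoTwinScarObject
import Summits.NavierStokesRegularity.NavierStokesRegularity.Theorems.TypeIQuarterGateQuarterLawTypeIGlue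
import Summits.NavierStokesRegularity.NavierStokesRegularity.Theorems.TypeIQuarterGateEnvelopeQuarterLaw
import Summits.NavierStokesRegularity.NavierStokesRegularity.Theorems.TypeIQuarterGateScarEnvelopeTypeINearOneRateDss
import Literature.Analysis.FluidPDE.AncientAxisymmetricTypeILiouville
import Summits.NavierStokesRegularity.NavierStokesRegularity.Theorems.TypeIQuarterGateScarEnvelopeTypeIZoomDictionaryLemmas
import Summits.NavierStokesRegularity.NavierStokesRegularity.Theorems.TypeIQuarterGateScarEnvelopeTypeIZoomDictionaryUnit
import Summits.NavierStokesRegularity.NavierStokesRegularity.Theorems.TypeIQuarterGateScarEnvelopeTypeIZoomDictionaryPersistence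
import Summits.NavierStokesRegularity.NavierStokesRegularity.Theorems.TypeIQuarterGateScarEnvelopeTypeIZoomDictionaryLargeSatellites
import Summits.NavierStokesRegularity.NavierStokesRegularity.Theorems.TypeIQuarterGateScarEnvelopeTypeISatelliteTowerDefs

/-!
# Part K1–K3, K5, K6: the satellite tower — time shift, tower objects, the class dictionary, plain pressure bounds, the engine class

Part K of the plate (ROUND-31 prep): K1 `tshift` invariances, K2/K3 `TowerObj` and the class dictionary `towerDictionary(_inBall)`, K5 plain pressure bounds at all sub-radii (Seregin–Šverák iteration), K6 the engine class `ABTower` (A–B objects are tower objects) and its dictionary.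

PROVENANCE: declaration texts VERBATIM from the HOME plates of the instrument seat nsreg-p3 (g24/g25, cell
`pub/ns-regularity-ideate`): `round-31/Tangent31prep.lean` v5 (sha16 `e5b8668e3a090216`; = ROUND-30 plate v10 + Part K) and,
for Part L, `round-32/Tangent32prep.lean` v6 (sha16 `6123f27718636121`);
the author cannot write under `Theorems/` (`perm.theorems-prover-only`); landed by the
LEAD-lineage prover ns-sz-p1 g5 on director-ns DIRECTOR-NS #218 (2), split into ≤ 400-line modules (the
plate's `def`s gathered in `TypeIQuarterGateScarEnvelopeTypeIZoomDictionaryDefs`), namespace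
`Summit.NavierStokesRegularity.NavierStokesRegularity.Cruxes.ScarEnvelopeTypeI.ZoomDictionary` (the plate's `NsregP3.R30P`), `E3` spelled out, one-line docstrings
added where the plate had none.  `--supports stmt-NavierStokesRegularity-23843 --as helper`.

HONEST FRAMING: dictionary / census TOOLING for the crux `TypeIQuarterGate.ScarEnvelopeTypeI` (item 23843):
equivalences and normal forms, kernel-checked; NO open statement is proved — 23843, its parent
`QuarterLawTypeI` (23726), the route and Navier–Stokes regularity are OPEN; hard core evaded: none.
-/

-- the summit-side namespace repeats a component by design (single-conjunct summit, D-0017)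
set_option linter.dupNamespace false

open MeasureTheory Set Metric Filter Topology
open scoped ENNReal

namespace Summit.NavierStokesRegularity.NavierStokesRegularity.Cruxes.ScarEnvelopeTypeI.ZoomDictionary

variable {u : ℝ → (EuclideanSpace ℝ (Fin 3)) → (EuclideanSpace ℝ (Fin 3))} {a : (EuclideanSpace ℝ (Fin 3))} {ν T : ℝ}

section Tower

open Literature.Analysis.FluidPDE

variable {U : ℝ → (EuclideanSpace ℝ (Fin 3)) → (EuclideanSpace ℝ (Fin 3))} {P : ℝ → (EuclideanSpace ℝ (Fin 3)) → ℝ} {y' : (EuclideanSpace ℝ (Fin 3))} {ν : ℝ}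

/-! ### K1. The time shift -/

/-- `tshift U s x = U (s − 1) x` (the time shift placing the final time at `1`). [folklore] -/
@[simp] theorem tshift_apply {F : Type*} (U : ℝ → (EuclideanSpace ℝ (Fin 3)) → F) (s : ℝ) (x : (EuclideanSpace ℝ (Fin 3))) :
    tshift U s x = U (s - 1) x := rfl

/-- Zooms of the shifted flow at `(1, y')` are zooms of `U` at `(0, y')`. [folklore] -/
theorem zoom_tshift (U : ℝ → (EuclideanSpace ℝ (Fin 3)) → (EuclideanSpace ℝ (Fin 3))) (y' : (EuclideanSpace ℝ (Fin 3))) (ℓ : ℝ) :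
    zoom (tshift U) y' 1 ℓ = zoom U y' 0 ℓ := by
  funext s y
  simp only [zoom, tshift_apply]
  rw [show (1 : ℝ) + ℓ ^ 2 * s - 1 = 0 + ℓ ^ 2 * s by ring]

/-- Pressure zooms of the shifted pressure at `(1, y')` are pressure zooms at `(0, y')`. [folklore] -/
theorem zoomP_tshift (P : ℝ → (EuclideanSpace ℝ (Fin 3)) → ℝ) (y' : (EuclideanSpace ℝ (Fin 3))) (ℓ : ℝ) :
    zoomP (tshift P) y' 1 ℓ = zoomP P y' 0 ℓ := by
  funext s y
  simp only [zoomP, tshift_apply]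
  rw [show (1 : ℝ) + ℓ ^ 2 * s - 1 = 0 + ℓ ^ 2 * s by ring]

/-- Tangent flows are invariant under the time shift. [folklore] -/
theorem tangentU_tshift_iff {L : ℕ → ℝ} {Ū : ℝ → (EuclideanSpace ℝ (Fin 3)) → (EuclideanSpace ℝ (Fin 3))} :
    TangentU (tshift U) (tshift P) y' 1 L Ū ↔ TangentU U P y' 0 L Ū := by
  simp only [TangentU, zoom_tshift, zoomP_tshift]

/-- `ZoomsInBall` is invariant under the time shift. [folklore] -/
theorem zoomsInBall_tshift_iff : ZoomsInBall (tshift U) (tshift P) y' 1 ↔ ZoomsInBall U P y' 0 := by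
  simp only [ZoomsInBall, zoom_tshift, zoomP_tshift]

/-- `ZoomsBddU` is invariant under the time shift. [folklore] -/
theorem zoomsBddU_tshift_iff : ZoomsBddU (tshift U) (tshift P) y' 1 ↔ ZoomsBddU U P y' 0 := by
  simp only [ZoomsBddU, zoom_tshift, zoomP_tshift]

/-- The annular cube of the shifted flow at time `t` is that of `U` at `t − 1`. [folklore] -/
theorem octaveCube_tshift (U : ℝ → (EuclideanSpace ℝ (Fin 3)) → (EuclideanSpace ℝ (Fin 3))) (a : (EuclideanSpace ℝ (Fin 3))) (ℓ t : ℝ) :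
    octaveCube (tshift U) a ℓ t = octaveCube U a ℓ (t - 1) := rfl

/-- The slice budget is shift invariant: budget of `tshift U` at final time `1` = budget of `U` at
final time `0`. -/
theorem budgetAt_tshift_iff {a : (EuclideanSpace ℝ (Fin 3))} : BudgetAt ν 1 (tshift U) a ↔ BudgetAt ν 0 U a := by
  constructor
  · rintro ⟨q, δ, r₀, hδ, hr₀, h⟩
    refine ⟨q, δ, r₀, hδ, hr₀, fun t ht ℓ h1 h2 => ?_⟩
    have ht' : t + 1 ∈ Ioo (1 - δ) 1 := ⟨by linarith [ht.1], by linarith [ht.2]⟩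
    have key := h (t + 1) ht' ℓ (by rwa [show (1 : ℝ) - (t + 1) = 0 - t by ring]) h2
    rwa [octaveCube_tshift, add_sub_cancel_right] at key
  · rintro ⟨q, δ, r₀, hδ, hr₀, h⟩
    refine ⟨q, δ, r₀, hδ, hr₀, fun t ht ℓ h1 h2 => ?_⟩
    rw [octaveCube_tshift]
    exact h (t - 1) ⟨by linarith [ht.1], by linarith [ht.2]⟩ ℓ
      (by rwa [show (0 : ℝ) - (t - 1) = 1 - t by ring]) h2

/-- Continuity on the open past passes to the shifted strip `(0,1) × ℝ³`. -/
theorem continuousOn_tshift (h : ContinuousOn (Function.uncurry U) (Iio 0 ×ˢ univ)) :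
    ContinuousOn (Function.uncurry (tshift U)) (Ioo 0 1 ×ˢ univ) := by
  have hφ : Continuous fun z : ℝ × (EuclideanSpace ℝ (Fin 3)) => (z.1 - 1, z.2) :=
    (continuous_fst.sub continuous_const).prodMk continuous_snd
  have hmaps : MapsTo (fun z : ℝ × (EuclideanSpace ℝ (Fin 3)) => (z.1 - 1, z.2)) (Ioo 0 1 ×ˢ univ) (Iio 0 ×ˢ univ) := by
    intro z hz
    refine ⟨?_, mem_univ _⟩
    have := hz.1.2
    simp only [mem_Iio]
    linarith
  have e : Function.uncurry (tshift U) = Function.uncurry U ∘ fun z : ℝ × (EuclideanSpace ℝ (Fin 3)) => (z.1 - 1, z.2) := by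
    funext z; rfl
  rw [e]
  exact h.comp hφ.continuousOn hmaps

/-- The Type-I rate of an ancient flow is the Type-I blow-up rate of its shift at `T = 1`. -/
theorem isTypeIBlowup_tshift {M : ℝ} (h : HasTypeITimeDecay M U) : IsTypeIBlowup (tshift U) 1 := by
  refine ⟨M, ?_⟩
  filter_upwards [self_mem_nhdsWithin] with t ht x
  have ht' : t - 1 < 0 := by
    have : t < 1 := ht
    linarith
  have key := h (t - 1) ht' x
  rwa [tshift_apply, show (1 : ℝ) - t = -(t - 1) by ring]

/-! ### K2. The class inputs at a final-time point of an ancient flow -/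

/-- `ZoomsInBall` at every final-time point of a pair that is suitable in every `Q_a(0)`
(restriction `of_subset_zero` + transport `.zoom`). -/
theorem zoomsInBall_of_inBall
    (h : ∀ a : ℝ, 0 < a → IsSuitableWeakSolutionInBall a (0 : ℝ × (EuclideanSpace ℝ (Fin 3))) U P) (y' : (EuclideanSpace ℝ (Fin 3))) :
    ZoomsInBall U P y' 0 := by
  refine ⟨1, one_pos, fun L hL _ => ?_⟩
  have hsub : parabolicCylinder L ((0 : ℝ), y') ⊆ parabolicCylinder (‖y'‖ + L) (0 : ℝ × (EuclideanSpace ℝ (Fin 3))) :=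
    parabolicCylinder_subset_zero
      (pow_le_pow_left₀ hL.le (by linarith [norm_nonneg y']) 2) le_rfl
  have h1 : IsSuitableWeakSolutionInBall L ((0 : ℝ), y') U P :=
    (h (‖y'‖ + L) (by positivity)).of_subset_zero hL hsub
  have h2 := h1.zoom hL
  rw [zoom_eq_smul_stPull, zoomP_eq_smul_stPull]
  exact h2

/-- `ZoomsBddU` at a final-time point from plain apex bounds `C, D ≤ K` there (Part D's
`zoomsBddU_of_vertexBounds` at the vertex `(0, y')`). -/
theorem zoomsBddU_of_apexBounds {K : NNReal} {r₁ : ℝ} (hr₁ : 0 < r₁)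
    (hC : ∀ r, 0 < r → r ≤ r₁ → cknC r (((0 : ℝ), y') : ℝ × (EuclideanSpace ℝ (Fin 3))) U ≤ K)
    (hD : ∀ r, 0 < r → r ≤ r₁ → cknD r (((0 : ℝ), y') : ℝ × (EuclideanSpace ℝ (Fin 3))) P ≤ K) : ZoomsBddU U P y' 0 :=
  zoomsBddU_of_vertexBounds (T := 0) (a := y') ENNReal.coe_lt_top ENNReal.coe_lt_top hr₁ hC hD

/-! ### K3. Tower objects and the class dictionary -/

/-- The dictionary hypotheses of the shifted tower object at every final-time point. -/
theorem TowerObj.inputs {M : ℝ} (h : TowerObj M U P) (y' : (EuclideanSpace ℝ (Fin 3))) :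
    ContinuousOn (Function.uncurry (tshift U)) (Ioo 0 1 ×ˢ univ) ∧ IsTypeIBlowup (tshift U) 1 ∧
      ZoomsInBall (tshift U) (tshift P) y' 1 ∧ ZoomsBddU (tshift U) (tshift P) y' 1 := by
  obtain ⟨hIB, hcont, hTI, hbd⟩ := h
  obtain ⟨K, hK⟩ := hbd y'
  exact ⟨continuousOn_tshift hcont, isTypeIBlowup_tshift hTI,
    zoomsInBall_tshift_iff.2 (zoomsInBall_of_inBall hIB y'),
    zoomsBddU_tshift_iff.2 (zoomsBddU_of_apexBounds one_pos
      (fun r hr hr1 => (hK r hr hr1).1) (fun r hr hr1 => (hK r hr hr1).2))⟩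

/-- **THE CLASS DICTIONARY (annulus form).** For a tower object and EVERY final-time point `y'`:
the annular cubic slice budget of `U` at `y'` holds iff every tangent flow of `U` at `(y', 0)` is
regular on the unit annulus.  (`dictionaryU'` one level down; F1–F3 tree theorems.) -/
theorem towerDictionary {M : ℝ} (h : TowerObj M U P) (y' : (EuclideanSpace ℝ (Fin 3))) :
    BudgetAt 1 0 U y' ↔ ∀ L Ū, TangentU U P y' 0 L Ū → ∀ y ∈ unitAnn, RegU Ū y := by
  obtain ⟨hc, hTI, hZ, hB⟩ := h.inputs y'
  have key := dictionaryU' (u := tshift U) (p := tshift P) (a := y') one_pos hc hTI hZ hB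
  rw [budgetAt_tshift_iff] at key
  simpa only [tangentU_tshift_iff] using key

/-- **THE CLASS DICTIONARY (satellite form).** For a tower object and every final-time point `y'`:
`BudgetAt 1 0 U y'` iff every tangent flow of `U` at `(y', 0)` is essentially bounded near every
final-time point `(0, y'')`, `0 < |y''| < 1` — «the satellite `y'` of `U` is tame iff the zooms of
`U` at `y'` are satellite-free». -/
theorem towerDictionary_inBall {M : ℝ} (h : TowerObj M U P) (y' : (EuclideanSpace ℝ (Fin 3))) :
    BudgetAt 1 0 U y' ↔ ∀ L Ū, TangentU U P y' 0 L Ū →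
      ∀ y'' : (EuclideanSpace ℝ (Fin 3)), y'' ≠ 0 → ‖y''‖ < 1 → RegPt Ū y'' := by
  obtain ⟨hc, hTI, hZ, hB⟩ := h.inputs y'
  have key := budgetAt_iff_noSatelliteInBall (u := tshift U) (p := tshift P) (a := y') one_pos hc
    hTI hZ hB
  rw [budgetAt_tshift_iff] at key
  simpa only [tangentU_tshift_iff] using key

/-! ### K5. Plain pressure bounds at all sub-radii (the Seregin–Šverák iteration)

The engine class (`LocalTypeIBlowup.exists_typeIAncientMild_zoomLimit_seq`, A–B's `𝐈 < ∞`) carries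
the pressure OSCILLATION `cknDOsc`; the dictionary input `ZoomsBddU` wants PLAIN `cknD ≤ K` at all
radii `≤ 1` in a fixed gauge.  The bridge is the iterated decay estimate
`D(θr) ≤ c(θ D(r) + θ⁻² C(r))` (`seregin_sverak_pressure_decay_holds.ratio`): with `cθ ≤ ½`,
`D(θᵏ) ≤ D(1) + 2cθ⁻²K` for all `k`, and monotonicity interpolates. -/

/-- Monotonicity of the un-normalised pressure integral: `D(r; z) ≤ (R/r)² D(R; z)`, `0 < r ≤ R`. -/
theorem cknD_le_sq_mul_cknD {r R : ℝ} (hr : 0 < r) (hrR : r ≤ R) (z : ℝ × (EuclideanSpace ℝ (Fin 3)))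
    (P : ℝ → (EuclideanSpace ℝ (Fin 3)) → ℝ) : cknD r z P ≤ ENNReal.ofReal ((R / r) ^ 2) * cknD R z P := by
  have hR : 0 < R := hr.trans_le hrR
  rw [cknD, cknD, Lemma142.inv_ofReal_sq hr, Lemma142.inv_ofReal_sq hR, ← mul_assoc,
    ← ENNReal.ofReal_mul (by positivity)]
  have e : (R / r) ^ 2 * (R ^ 2)⁻¹ = (r ^ 2)⁻¹ := by
    field_simp
  rw [e]
  exact mul_le_mul' le_rfl (lintegral_mono_set (parabolicCylinder_mono hr.le hrR z))

/-- One step of the iteration in `ℝ≥0∞`: `x ≤ D₀ + 2B`, `a ≤ ½` ⟹ `a x + B ≤ D₀ + 2B`. -/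
theorem iterStep_le {x D₀ B a : ℝ≥0∞} (hx : x ≤ D₀ + 2 * B) (ha : a ≤ 2⁻¹) :
    a * x + B ≤ D₀ + 2 * B := by
  calc a * x + B ≤ 2⁻¹ * (D₀ + 2 * B) + B := by gcongr
    _ = 2⁻¹ * D₀ + B + B := by
        rw [mul_add, ← mul_assoc, ENNReal.inv_mul_cancel (by norm_num) (by norm_num), one_mul]
    _ ≤ D₀ + B + B := by
        gcongr
        exact mul_le_of_le_one_left (by positivity) (ENNReal.inv_le_one.2 one_le_two)
    _ = D₀ + 2 * B := by rw [add_assoc, ← two_mul]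

/-- **Plain `D` is bounded at all radii `≤ 1`** for a distributional solution around `Q_1(z)` once
`C(r; z) ≤ K` for all `r ≤ 1` and `D(1; z) < ∞`. [Seregin–Šverák 2009, p. 10 «easily iterated»] -/
theorem exists_cknD_le_of_cknC_le {Q : TopologicalSpace.Opens (ℝ × (EuclideanSpace ℝ (Fin 3)))}
    (hsol : IsDistributionalNSSolutionOn Q 1 0 U P) {z : ℝ × (EuclideanSpace ℝ (Fin 3))}
    (hQ : parabolicCylinder 1 z ⊆ (Q : Set (ℝ × (EuclideanSpace ℝ (Fin 3))))) {K : NNReal}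
    (hC : ∀ r, 0 < r → r ≤ 1 → cknC r z U ≤ K) (hD1 : cknD 1 z P < ⊤) :
    ∃ D : NNReal, ∀ r, 0 < r → r ≤ 1 → cknD r z P ≤ D := by
  obtain ⟨c, hc⟩ := seregin_sverak_pressure_decay_holds.ratio
  -- the ratio `θ` with `c θ ≤ 1/2`
  set θ : ℝ := min (1 / 2) (1 / (2 * ((c : ℝ) + 1))) with hθdef
  have hc0 : (0 : ℝ) ≤ c := c.coe_nonneg
  have hθpos : 0 < θ := lt_min (by norm_num) (by positivity)
  have hθhalf : θ ≤ 1 / 2 := min_le_left _ _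
  have hθ1 : θ ≤ 1 := hθhalf.trans (by norm_num)
  have hθlt1 : θ < 1 := hθhalf.trans_lt (by norm_num)
  have hcθ : (c : ℝ) * θ ≤ 1 / 2 := by
    have h1 : θ ≤ 1 / (2 * ((c : ℝ) + 1)) := min_le_right _ _
    calc (c : ℝ) * θ ≤ (c : ℝ) * (1 / (2 * ((c : ℝ) + 1))) := by gcongr
      _ ≤ 1 / 2 := by
          rw [mul_one_div, div_le_iff₀ (by positivity)]
          nlinarith
  have ha : (c : ℝ≥0∞) * ENNReal.ofReal θ ≤ 2⁻¹ := by
    rw [← ENNReal.ofReal_coe_nnreal, ← ENNReal.ofReal_mul hc0]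
    calc ENNReal.ofReal ((c : ℝ) * θ) ≤ ENNReal.ofReal (1 / 2) := ENNReal.ofReal_le_ofReal hcθ
      _ = 2⁻¹ := by rw [one_div, ENNReal.ofReal_inv_of_pos two_pos, ENNReal.ofReal_ofNat]
  -- constants
  set B : ℝ≥0∞ := (c : ℝ≥0∞) * (ENNReal.ofReal ((θ⁻¹) ^ 2) * K) with hB
  have hBtop : B < ⊤ :=
    ENNReal.mul_lt_top ENNReal.coe_lt_top (ENNReal.mul_lt_top ENNReal.ofReal_lt_top ENNReal.coe_lt_top)
  set D₀ : ℝ≥0∞ := cknD 1 z P with hD₀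
  have hsubQ : ∀ r, 0 < r → r ≤ 1 → parabolicCylinder r z ⊆ (Q : Set (ℝ × (EuclideanSpace ℝ (Fin 3)))) :=
    fun r hr hr1 => (parabolicCylinder_mono hr.le hr1 z).trans hQ
  -- the iteration along `θ^k`
  have hiter : ∀ k : ℕ, cknD (θ ^ k) z P ≤ D₀ + 2 * B := by
    intro k
    induction k with
    | zero => rw [pow_zero]; exact le_self_add
    | succ k ih =>
      have hθk : 0 < θ ^ k := pow_pos hθpos k
      have hθk1 : θ ^ k ≤ 1 := pow_le_one₀ hθpos.le hθ1
      have step := hc Q U P hsol z (θ ^ k) θ hθk hθpos hθ1 (hsubQ _ hθk hθk1)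
      rw [pow_succ']
      calc cknD (θ * θ ^ k) z P
          ≤ c * (ENNReal.ofReal θ * cknD (θ ^ k) z P +
              ENNReal.ofReal ((θ⁻¹) ^ 2) * cknC (θ ^ k) z U) := step
        _ ≤ c * (ENNReal.ofReal θ * cknD (θ ^ k) z P + ENNReal.ofReal ((θ⁻¹) ^ 2) * K) := by
            gcongr
            exact hC _ hθk hθk1
        _ = (c * ENNReal.ofReal θ) * cknD (θ ^ k) z P + B := by rw [hB, mul_add, mul_assoc]
        _ ≤ D₀ + 2 * B := iterStep_le ih ha
  -- interpolation by monotonicity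
  set Dtot : ℝ≥0∞ := ENNReal.ofReal ((θ⁻¹) ^ 2) * (D₀ + 2 * B) with hDtot
  have hDtot : Dtot < ⊤ :=
    ENNReal.mul_lt_top ENNReal.ofReal_lt_top
      (ENNReal.add_lt_top.2 ⟨hD1, ENNReal.mul_lt_top (by simp) hBtop⟩)
  refine ⟨Dtot.toNNReal, fun r hr hr1 => ?_⟩
  rw [ENNReal.coe_toNNReal hDtot.ne]
  obtain ⟨k, hk1, hk2⟩ := exists_nat_pow_near_of_lt_one hr hr1 hθpos hθlt1
  have hθk : 0 < θ ^ k := pow_pos hθpos k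
  calc cknD r z P ≤ ENNReal.ofReal ((θ ^ k / r) ^ 2) * cknD (θ ^ k) z P :=
        cknD_le_sq_mul_cknD hr hk2 z P
    _ ≤ ENNReal.ofReal ((θ⁻¹) ^ 2) * (D₀ + 2 * B) := by
        gcongr
        · -- `θ^k / r ≤ θ⁻¹` from `θ^(k+1) < r`
          have hθne : θ ≠ 0 := hθpos.ne'
          rw [div_le_iff₀ hr]
          have h2 : θ ^ k * θ ≤ r := by rw [← pow_succ]; exact hk1.le
          calc θ ^ k = θ ^ k * θ * θ⁻¹ := by field_simp
            _ ≤ r * θ⁻¹ := by gcongr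
            _ = θ⁻¹ * r := mul_comm _ _
        · exact hiter k

/-! ### K6. The engine class: A–B objects are tower objects; the class dictionary for them

`ABTower M U P H` is the output class of the tree's blow-up engines
(`LocalTypeIBlowup.exists_typeIAncientMild_zoomLimit_seq`, `…twinZoomLimit_budget`): a Type-I
ancient mild flow, suitable in every `Q_a(0)`, with a weak gradient on the lower half-space and
A–B's Type-I quantity finite there.  `towerObj_of_abTower` feeds it to the class dictionary:
continuity and the rate come from mildness, `C ≤ 𝐈` from the Type-I quantity, PLAIN `D` at the
final-time apices from K5. -/

/-- `C(r; z) ≤` the Albritton–Barker scaled sum `A + E + C + D` at `(r, z)`. [folklore] -/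
theorem cknC_le_abScaledSum (r : ℝ) (z : ℝ × (EuclideanSpace ℝ (Fin 3))) (U : ℝ → (EuclideanSpace ℝ (Fin 3)) → (EuclideanSpace ℝ (Fin 3))) (P : ℝ → (EuclideanSpace ℝ (Fin 3)) → ℝ)
    (H : ℝ → (EuclideanSpace ℝ (Fin 3)) → (EuclideanSpace ℝ (Fin 3)) →L[ℝ] (EuclideanSpace ℝ (Fin 3))) : cknC r z U ≤ abScaledSum r z U P H := by
  rw [abScaledSum]
  calc cknC r z U ≤ cknAEss r z U + cknC r z U := le_add_self
    _ ≤ cknAEss r z U + cknC r z U + cknDOsc r z P := le_self_add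
    _ ≤ cknAEss r z U + cknC r z U + cknDOsc r z P + cknE r z H := le_self_add

/-- A final-time cylinder lies in the open lower half-space. -/
theorem parabolicCylinder_subset_lowerHalf (r : ℝ) (y' : (EuclideanSpace ℝ (Fin 3))) :
    parabolicCylinder r (((0 : ℝ), y') : ℝ × (EuclideanSpace ℝ (Fin 3))) ⊆ Iio (0 : ℝ) ×ˢ (univ : Set (EuclideanSpace ℝ (Fin 3))) := by
  intro w hw
  rw [mem_parabolicCylinder] at hw
  exact ⟨hw.1.2, mem_univ _⟩

/-- `D(1; (0,y')) < ∞` for a pair in A–B's class on the ball `Q_{|y'|+2}(0)`. -/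
theorem cknD_one_lt_top_of_inBall
    (h : ∀ a : ℝ, 0 < a → IsSuitableWeakSolutionInBall a (0 : ℝ × (EuclideanSpace ℝ (Fin 3))) U P) (y' : (EuclideanSpace ℝ (Fin 3))) :
    cknD 1 (((0 : ℝ), y') : ℝ × (EuclideanSpace ℝ (Fin 3))) P < ⊤ := by
  have ha : 0 < ‖y'‖ + 2 := by positivity
  obtain ⟨-, -, -, hp⟩ := h (‖y'‖ + 2) ha
  have hsub : parabolicCylinder 1 (((0 : ℝ), y') : ℝ × (EuclideanSpace ℝ (Fin 3))) ⊆ parabolicCylinder (‖y'‖ + 2) (0 : ℝ × (EuclideanSpace ℝ (Fin 3))) :=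
    parabolicCylinder_subset_zero (by nlinarith [norm_nonneg y']) (by linarith)
  have hlt := hp.eLpNorm_lt_top
  rw [eLpNorm_lt_top_iff_lintegral_rpow_enorm_lt_top (by norm_num)
    (ENNReal.div_ne_top (by norm_num) (by norm_num))] at hlt
  have e : (3 / 2 : ℝ≥0∞).toReal = 3 / 2 := by rw [ENNReal.toReal_div]; norm_num
  rw [e] at hlt
  rw [cknD, ENNReal.ofReal_one, one_pow, inv_one, one_mul]
  exact lt_of_le_of_lt (lintegral_mono_set hsub) hlt

/-- **A–B objects are tower objects.** -/
theorem towerObj_of_abTower {M : ℝ} {H : ℝ → (EuclideanSpace ℝ (Fin 3)) → (EuclideanSpace ℝ (Fin 3)) →L[ℝ] (EuclideanSpace ℝ (Fin 3))} (h : ABTower M U P H) :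
    TowerObj M U P := by
  obtain ⟨hmild, hIB, hH, hI⟩ := h
  refine ⟨hIB, hmild.1.continuousOn, hmild.2.2.2, fun y' => ?_⟩
  set I : ℝ≥0∞ := typeIBound (Iio (0 : ℝ) ×ˢ univ) U P H with hIdef
  -- `C ≤ 𝐈` at every radius
  have hC : ∀ r, 0 < r → cknC r (((0 : ℝ), y') : ℝ × (EuclideanSpace ℝ (Fin 3))) U ≤ I.toNNReal := by
    intro r hr
    rw [ENNReal.coe_toNNReal hI.ne]
    exact (cknC_le_abScaledSum r _ U P H).trans
      (abScaledSum_le_typeIBound hr (parabolicCylinder_subset_lowerHalf r y'))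
  -- plain `D` at radii ≤ 1 by K5
  have ha : 0 < ‖y'‖ + 2 := by positivity
  have hsub : parabolicCylinder 1 (((0 : ℝ), y') : ℝ × (EuclideanSpace ℝ (Fin 3))) ⊆
      ((parabolicCylinderOpens (‖y'‖ + 2) (0 : ℝ × (EuclideanSpace ℝ (Fin 3))) : TopologicalSpace.Opens (ℝ × (EuclideanSpace ℝ (Fin 3)))) :
        Set (ℝ × (EuclideanSpace ℝ (Fin 3)))) := by
    rw [coe_parabolicCylinderOpens]
    exact parabolicCylinder_subset_zero (by nlinarith [norm_nonneg y']) (by linarith)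
  obtain ⟨D, hD⟩ := exists_cknD_le_of_cknC_le (hIB _ ha).1.distributional hsub
    (fun r hr _ => hC r hr) (cknD_one_lt_top_of_inBall hIB y')
  refine ⟨max I.toNNReal D, fun r hr hr1 => ⟨(hC r hr).trans ?_, (hD r hr hr1).trans ?_⟩⟩
  · exact ENNReal.coe_le_coe.2 (le_max_left _ _)
  · exact ENNReal.coe_le_coe.2 (le_max_right _ _)

/-- **The class dictionary for A–B objects** (annulus form). -/
theorem abTower_dictionary {M : ℝ} {H : ℝ → (EuclideanSpace ℝ (Fin 3)) → (EuclideanSpace ℝ (Fin 3)) →L[ℝ] (EuclideanSpace ℝ (Fin 3))} (h : ABTower M U P H) (y' : (EuclideanSpace ℝ (Fin 3))) :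
    BudgetAt 1 0 U y' ↔ ∀ L Ū, TangentU U P y' 0 L Ū → ∀ y ∈ unitAnn, RegU Ū y :=
  towerDictionary (towerObj_of_abTower h) y'

/-- **The class dictionary for A–B objects** (satellite form): the slice budget of `U` at a
final-time point `y'` holds iff the tangent flows of `U` at `y'` are satellite-free in the unit ball. -/
theorem abTower_dictionary_inBall {M : ℝ} {H : ℝ → (EuclideanSpace ℝ (Fin 3)) → (EuclideanSpace ℝ (Fin 3)) →L[ℝ] (EuclideanSpace ℝ (Fin 3))} (h : ABTower M U P H)
    (y' : (EuclideanSpace ℝ (Fin 3))) :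
    BudgetAt 1 0 U y' ↔ ∀ L Ū, TangentU U P y' 0 L Ū →
      ∀ y'' : (EuclideanSpace ℝ (Fin 3)), y'' ≠ 0 → ‖y''‖ < 1 → RegPt Ū y'' :=
  towerDictionary_inBall (towerObj_of_abTower h) y'

end Tower

end Summit.NavierStokesRegularity.NavierStokesRegularity.Cruxes.ScarEnvelopeTypeI.ZoomDictionary
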